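import Mathlib
import Literature.Analysis.FluidPDE.TypeIAncientMild
import Literature.Analysis.FluidPDE.SelfSimilar
import Literature.ComputerArithmetic.BrentZimmermann2010.CommensurableBases
import Summits.NavierStokesRegularity.NavierStokesRegularity.Theses.SymmetryModuliCount
import Summits.NavierStokesRegularity.NavierStokesRegularity.Theorems.ScenarioCensusScrewBlowdownVanishing
import Summits.NavierStokesRegularity.NavierStokesRegularity.Theorems.DssFarFieldSlavingBlowupTypeIDssProfileSimilarityEnstrophyTimeOnlyThreshold
import Summits.NavierStokesRegularity.NavierStokesRegularity.Theorems.ScenarioCensusScalingSpectrum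
import Summits.NavierStokesRegularity.NavierStokesRegularity.Theorems.ScenarioCensusScalingSpectrumCentre
import Summits.NavierStokesRegularity.NavierStokesRegularity.Theorems.ClockStretchingLawClockCeilingGermRigidity
import Summits.NavierStokesRegularity.NavierStokesRegularity.Theorems.PoloidalWindowDoorPoloidalWindowRigidityStrata
import HarnessLib
import Summits.NavierStokesRegularity.NavierStokesRegularity.Theorems.TypeIQuarterGateScarEnvelopeTypeINearOneRateDss

/-!
# Block A2, instrument HULL METER (ns-idea-2 LINE g17-1 REV 3; cells A2huN / S / R / F / C / D / Df / 2c DECIDED, A2huL / A2huDL OPEN ≡ D7) — port, part 1/4: §A the blow-down hull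
# and the zoom dictionary; §B extraction with memory of loudness, one-limit Liouville; §C the arithmetic levers (past truncation, `log 2 / log 3 ∉ ℚ`, the ×2×3 and near-one past
# Liouville theorems — the tree's `NearOneRateDss` BY NAME)

Re-homed for the scenario census (typer seat ns-census-typer-1 g10; the cells A2huN / A2huS / A2huR / A2huF / A2huC / A2huD / A2huDf / A2hu2c are MEMBERS OF RECORD «DECIDED IN KERNEL IN
FILES» of row A2 (item 76: REV 1 critic PASS, REV 3 idea-crit-3 g10 ROW WORDS BY KEY 11:55:14Z; ref PRE-CHECK ✓ §18.33; lead label LBL76r3), A2huL / A2huDL OPEN ≡ D7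
(`CoarsePastLiouville`); this port makes the decided cells TREE-decided): VERBATIM PORT of ns-idea-2 LINE g17-1 «hull-meter» REV 3,
`pub/ideators/ns-idea-2/lines/hull-meter/line-hull-meter.rev3.lean` sha16 ab921f346883452d (1125 l., lean check rc 0, 0 sorry), split for the 400-line rule into
`ScenarioCensusHullMeter` (§A–§C) → `…HullMeterDials` (§D–§F) → `…HullMeterRows` (§G, §H, §G′) → `…HullMeterTwoCentre` (§G″, §I + census KEYS).  Lean text VERBATIM in namespace
`…Theorems.ScenarioCensus.HullMeter` (the line's `…Lines.HullMeter` re-homed); port edits: the line's `local notation "E3"` is spelled as the reducible `abbrev E3` of every census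
file; the line's import of the crux workfile `Cruxes/ScarEnvelopeTypeI/Lines/axis_activity` is replaced by its landed Theorems home
`Theorems.TypeIQuarterGateScarEnvelopeTypeINearOneRateDss` (same namespace `…Cruxes.ScarEnvelopeTypeI.AxisActivity`, same names `NearOneRateDss` / `nearOneRateDss_proof` /
`isDiscretelySelfSimilar_pow`); `set_option linter.unusedVariables false` dropped (binders the linter names are `_`-prefixed); `@[conjecture]` on the OPEN statements `CoarsePastLiouville`,
`CoarseGapLaw`, `Row_A2huL`, `Row_A2huDL` (≡ census D7, OPEN); one-line docstrings added where missing (gate lint).  Statements untouched.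

No census VALUE is moved here (row A2 stays OPEN-WITH-LINE; the members become TREE-decided by name); D7 / (L′) are NOT proved; no summit statement is proved by this file.
-/

-- the summit and its single problem share the name `NavierStokesRegularity` (D-0017 nested layout)
set_option linter.dupNamespace false

noncomputable section

open Set Function Filter Metric
open scoped Topology
open Literature.Analysis Literature.Analysis.FluidPDE
open Summit.NavierStokesRegularity.NavierStokesRegularity.Theorems
open Summit.NavierStokesRegularity.NavierStokesRegularity.Theorems.ScenarioCensus.ScrewBlowdown
open Summit.NavierStokesRegularity.NavierStokesRegularity.Theorems.ScenarioCensus.ScalingSpectrum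
open Summit.NavierStokesRegularity.NavierStokesRegularity.Theorems.PoloidalWindowDoorPoloidalWindowRigidityStrata
open Summit.NavierStokesRegularity.NavierStokesRegularity.Cruxes.ScarEnvelopeTypeI.AxisActivity
open Literature.ComputerArithmetic.BrentZimmermann2010.CommensurableBases

namespace Summit.NavierStokesRegularity.NavierStokesRegularity.Theorems.ScenarioCensus.HullMeter

/-- `ℝ³` (the line's `local notation "E3"`, spelled as a reducible abbreviation for the tree). -/
abbrev E3 := EuclideanSpace ℝ (Fin 3)

variable {C : ℝ} {u : ℝ → E3 → E3}

/-! ## A. The instrument: the blow-down hull and the zoom dictionary -/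

/-- The BLOW-DOWN HULL of `u` at Type-I constant `C`: all blow-down limits (tree `IsBlowdownLimit`: `W ∈ A_C` and
`u_{μₖ}(t, ·) → W(t, ·)` locally uniformly for every `t < 0` along some `μₖ → ∞`). -/
def hull (C : ℝ) (u : ℝ → E3 → E3) : Set (ℝ → E3 → E3) := {W | IsBlowdownLimit C u W}

/-- Membership in the hull, unfolded. -/
theorem mem_hull {W : ℝ → E3 → E3} : W ∈ hull C u ↔ IsBlowdownLimit C u W := Iff.rfl

/-- PAST TRUNCATION (hull members are determined by their past only; cardinality is read through it). -/
def pastPart (W : ℝ → E3 → E3) : ℝ → E3 → E3 := fun t x => if t < 0 then W t x else 0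

/-- The past truncation agrees with `W` on the past. -/
theorem pastPart_of_neg {W : ℝ → E3 → E3} {t : ℝ} (ht : t < 0) (x : E3) : pastPart W t x = W t x := if_pos ht

/-- The past truncation vanishes off the past. -/
theorem pastPart_of_not_neg {W : ℝ → E3 → E3} {t : ℝ} (ht : ¬ t < 0) (x : E3) : pastPart W t x = 0 := if_neg ht

/-- The hull counted MODULO THE PAST. -/
def pastHull (C : ℝ) (u : ℝ → E3 → E3) : Set (ℝ → E3 → E3) := pastPart '' hull C u

/-- ZOOM DICTIONARY: zooms compose multiplicatively (`nsRescale_mul`). -/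
theorem nsRescale_nsRescale (c μ : ℝ) (v : ℝ → E3 → E3) (t : ℝ) (x : E3) :
    nsRescale c (nsRescale μ v) t x = nsRescale (μ * c) v t x := by
  rw [nsRescale_mul]

/-- PAST INVARIANCE of `W` under the zooms by the factors in `F` (DSS «on the past»). -/
def PastInvariant (F : Set ℝ) (W : ℝ → E3 → E3) : Prop :=
  ∀ c ∈ F, ∀ t < (0 : ℝ), ∀ x : E3, nsRescale c W t x = W t x

/-- The PAST LIOUVILLE PROPERTY of a factor set `F` at constant `C`: every `W ∈ A_C` that is past-invariant under
the zooms by all `c ∈ F` vanishes on the past.  (`F = {2,3}`: PROVED, §C; `F = {λ₀}`, `λ₀` near one: PROVED from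
the tree's `NearOneRateDss`, §C; `F = {λ₀}`, `λ₀ > 1` arbitrary: census D7, OPEN.) -/
def PastLiouville (C : ℝ) (F : Set ℝ) : Prop :=
  ∀ W : ℝ → E3 → E3, IsTypeIAncientMild C W → PastInvariant F W → ∀ t < (0 : ℝ), ∀ x : E3, W t x = 0

/-! ## B. Extraction with memory of loudness; one-limit Liouville -/

/-- **Zoom extraction.** For `u ∈ A_C` and scales `sₖ → ∞`, a subsequence of the zooms converges (pointwise on the past
and slice-locally-uniformly) to a hull member. -/
theorem exists_hull_limit (hu : IsTypeIAncientMild C u) {s : ℕ → ℝ} (hspos : ∀ k, 0 < s k)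
    (hslim : Tendsto s atTop atTop) :
    ∃ φ : ℕ → ℕ, StrictMono φ ∧ ∃ W : ℝ → E3 → E3, W ∈ hull C u ∧ IsTypeIAncientMild C W ∧
      (∀ t < 0, ∀ x, Tendsto (fun j => nsRescale (s (φ j)) u t x) atTop (𝓝 (W t x))) ∧
      (∀ t < 0, TendstoLocallyUniformly (fun j => nsRescale (s (φ j)) u t) (W t) atTop) := by
  obtain ⟨φ, hφ, W, hW, hpt, -, hloc, -⟩ :=
    exists_tendsto_of_isTypeIAncientMild_seq C (w := fun k => nsRescale (s k) u)
      fun k => zoom_isTypeIAncientMild hu (hspos k)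
  exact ⟨φ, hφ, W, ⟨hW, fun j => s (φ j), fun j => hspos _, hslim.comp hφ.tendsto_atTop,
    fun t ht => hloc t ht⟩, hW, hpt, hloc⟩

/-- The hull is never empty. -/
theorem hull_nonempty (hu : IsTypeIAncientMild C u) : (hull C u).Nonempty := by
  obtain ⟨φ, -, W, hWh, -⟩ := exists_hull_limit hu (s := fun k : ℕ => (k : ℝ) + 1) (fun k => by positivity)
    (tendsto_natCast_atTop_atTop.atTop_add tendsto_const_nhds)
  exact ⟨W, hWh⟩

/-- **Loud limits (S3 «substantiality» read on one slice).** If zooms of `u ∈ A_C` along `νⱼ → ∞` converge locally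
uniformly on the slice `t = −1` to a function vanishing there, then `u ≡ 0` on the past. -/
theorem eq_zero_of_sliceLimit_zero (hu : IsTypeIAncientMild C u) {ν : ℕ → ℝ} (hνlim : Tendsto ν atTop atTop)
    {w : E3 → E3} (hconv : TendstoLocallyUniformly (fun j => nsRescale (ν j) u (-1)) w atTop)
    (h0 : ∀ x, w x = 0) : ∀ t < 0, ∀ x, u t x = 0 := by
  by_contra hne
  push Not at hne
  obtain ⟨t₀, ht₀, x₀, hx₀⟩ := hne
  obtain ⟨ε, hε, K, hK, hsub⟩ := substantial_at_large_scales C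
  obtain ⟨μ₁, hμ₁, hloud⟩ := hsub u hu ⟨t₀, ht₀, x₀, hx₀⟩
  have hK' : IsCompact (closedBall (0 : E3) K) := isCompact_closedBall _ _
  have hunif : TendstoUniformlyOn (fun j => nsRescale (ν j) u (-1)) w atTop (closedBall (0 : E3) K) :=
    (tendstoLocallyUniformlyOn_iff_tendstoUniformlyOn_of_compact hK').1 hconv.tendstoLocallyUniformlyOn
  have hev := (Metric.tendstoUniformlyOn_iff.1 hunif) ε hε
  have hev2 : ∀ᶠ j in atTop, μ₁ ≤ ν j := hνlim.eventually_ge_atTop μ₁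
  obtain ⟨j, hj, hj2⟩ := (hev.and hev2).exists
  obtain ⟨y, hyK, hbig⟩ := hloud (ν j) hj2
  have hyj : y ∈ closedBall (0 : E3) K := by rw [mem_closedBall, dist_zero_right]; exact hyK
  have h1 := hj y hyj
  rw [h0 y, dist_zero_left] at h1
  exact absurd h1 (not_lt.2 hbig.le)

/-- **One-limit Liouville** (g16, credited): ONE blow-down limit vanishing on the past forces `u ≡ 0` on the past. -/
theorem eq_zero_of_zero_mem_hull (hu : IsTypeIAncientMild C u) {W : ℝ → E3 → E3} (hW : W ∈ hull C u)
    (h0 : ∀ t < 0, ∀ x, W t x = 0) : ∀ t < 0, ∀ x, u t x = 0 := by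
  obtain ⟨-, ν, -, hνlim, hconv⟩ := mem_hull.1 hW
  exact eq_zero_of_sliceLimit_zero hu hνlim (hconv (-1) (by norm_num)) (h0 (-1) (by norm_num))

/-! ## C. The arithmetic levers: truncation, `log 2 / log 3 ∉ ℚ`, the ×2×3 and near-one past Liouville theorems -/

/-- Truncation to the past keeps the class (pattern of the tree's `isTypeIAncientMild_truncate`, re-proved to keep the
import closure small). -/
theorem isTypeIAncientMild_pastPart {W : ℝ → E3 → E3} (h : IsTypeIAncientMild C W) :
    IsTypeIAncientMild C (pastPart W) := by
  have hslice : ∀ t : ℝ, t < 0 → pastPart W t = W t := fun t ht => funext fun x => if_pos ht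
  refine ⟨?_, fun t ht => ?_, fun s t hst ht x => ?_, fun t ht x => ?_⟩
  · refine h.contDiffOn.congr ?_
    rintro ⟨t, x⟩ ⟨ht, -⟩
    simp only [uncurry_apply_pair, pastPart, if_pos (show t < 0 from ht)]
  · rw [hslice t ht]; exact h.isDivFree ht
  · have hs : s < 0 := hst.trans ht
    rw [pastPart_of_neg ht, hslice s hs, h.mild_eq hst ht x, oseenDuhamel_apply, oseenDuhamel_apply]
    congr 1
    refine MeasureTheory.setIntegral_congr_fun measurableSet_Ioo fun τ hτ => ?_
    simp only [hslice τ (hτ.2.trans ht)]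
  · rw [pastPart_of_neg ht]; exact h.norm_le ht x

/-- Past invariance of `W` makes its past truncation GLOBALLY discretely self-similar. -/
theorem isDiscretelySelfSimilar_pastPart {W : ℝ → E3 → E3} {c : ℝ} (hc : 0 < c)
    (h : ∀ t < (0 : ℝ), ∀ x : E3, nsRescale c W t x = W t x) : IsDiscretelySelfSimilar c (pastPart W) := by
  show nsRescale c (pastPart W) = pastPart W
  funext t x
  by_cases ht : t < 0
  · have hct : c ^ 2 * t < 0 := mul_neg_of_pos_of_neg (by positivity) ht
    rw [nsRescale_apply, pastPart_of_neg hct, pastPart_of_neg ht, ← h t ht x, nsRescale_apply]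
  · have hct : ¬ c ^ 2 * t < 0 := not_lt.2 (mul_nonneg (sq_nonneg c) (not_lt.1 ht))
    rw [nsRescale_apply, pastPart_of_not_neg hct, pastPart_of_not_neg ht, smul_zero]

/-- Past invariance iterates along the powers of the factor. -/
theorem pastInvariant_pow {W : ℝ → E3 → E3} {c : ℝ} (hc : 0 < c)
    (h : ∀ t < (0 : ℝ), ∀ x : E3, nsRescale c W t x = W t x) :
    ∀ k : ℕ, ∀ t < (0 : ℝ), ∀ x : E3, nsRescale (c ^ k) W t x = W t x := by
  intro k
  induction k with
  | zero => intro t ht x; rw [pow_zero, nsRescale_one]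
  | succ k ih =>
    intro t ht x
    have hct : c ^ 2 * t < 0 := mul_neg_of_pos_of_neg (by positivity) ht
    rw [pow_succ, nsRescale_mul, nsRescale_apply, ih _ hct, ← nsRescale_apply (c := c) (u := W), h t ht x]

/-- `log 2 / log 3` is irrational — unique factorisation (`2 ∣ 3ⁿ` is impossible), via Brent–Zimmermann Ex. 1.33
(`BasesCommensurable 2 3 ↔ log 2 / log 3 ∈ ℚ`).  The tree's bi-DSS `example` leaves this to the caller; here it is. -/
theorem irrational_log_two_div_log_three : Irrational (Real.log 2 / Real.log 3) := by
  have key : ¬ BasesCommensurable 2 3 := by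
    rw [commensurable_iff_pow_eq_pow (le_refl 2) (by norm_num)]
    rintro ⟨m, n, hm, hn, h⟩
    have h2 : 2 ∣ 2 ^ m := dvd_pow_self 2 hm.ne'
    rw [h] at h2
    have h3 : 2 ∣ 3 := Nat.Prime.dvd_of_dvd_pow Nat.prime_two h2
    omega
  have e := (exercise_1_33 (B := 2) (β := 3) (le_refl 2) (by norm_num)).not.mp key
  push_cast at e
  rintro ⟨q, hq⟩
  exact e ⟨q, hq.symm⟩

/-- **×2×3 LIOUVILLE ON THE PAST** (`PastLiouville C {2, 3}`, every `C`): a field of `A_C` invariant on the past under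
the zooms by `2` and by `3` vanishes on the past — its past truncation is globally 2- and 3-DSS, and the tree's bi-DSS
row (`row_DbiT_holds`: Kronecker density of `log 2·ℤ + log 3·ℤ` + closedness of the scaling group + the backward
self-similar Liouville theorem) kills it. -/
theorem pastLiouville_two_three (C : ℝ) : PastLiouville C {2, 3} := by
  intro W hW hinv t ht x
  have h2 : ∀ t < (0 : ℝ), ∀ x : E3, nsRescale 2 W t x = W t x := hinv 2 (by simp)
  have h3 : ∀ t < (0 : ℝ), ∀ x : E3, nsRescale 3 W t x = W t x := hinv 3 (by simp)
  have hz := row_DbiT_holds C (pastPart W) 2 3 (isTypeIAncientMild_pastPart hW) two_pos three_pos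
    irrational_log_two_div_log_three (isDiscretelySelfSimilar_pastPart two_pos h2)
    (isDiscretelySelfSimilar_pastPart three_pos h3) t ht x
  rwa [pastPart_of_neg ht] at hz

/-- **NEAR-ONE LIOUVILLE ON THE PAST** (`PastLiouville C {λ₀}` for `1 < λ₀ < c₁(C)`): from the tree's PROVED rung
`NearOneRateDss` (census D5r: near-one DSS exclusion in the time-rate class, no envelope) applied to the past truncation. -/
theorem pastLiouville_nearOne (C : ℝ) :
    ∃ c₁ : ℝ, 1 < c₁ ∧ ∀ lam : ℝ, 1 < lam → lam < c₁ → PastLiouville C {lam} := by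
  obtain ⟨c₁, hc₁, H⟩ := nearOneRateDss_proof C
  refine ⟨c₁, hc₁, fun lam h1 h2 W hW hinv t ht x => ?_⟩
  have hz := H lam h1 h2 (pastPart W) (isTypeIAncientMild_pastPart hW)
    (isDiscretelySelfSimilar_pastPart (one_pos.trans h1) (hinv lam rfl)) t ht x
  rwa [pastPart_of_neg ht] at hz

end Summit.NavierStokesRegularity.NavierStokesRegularity.Theorems.ScenarioCensus.HullMeter

end
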